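import Mathlib.Analysis.SpecialFunctions.Pow.Real
import Mathlib.Algebra.Order.Chebyshev
import HarnessLib

/-!
# `TwTipContinuation` (stmt-HubbardSuperconductivity-1700), line `isogap-submodular-transport`,
# stub `stub_edgeOrder` — piece 3a(v): transferring an ensemble energy bound to one sector

Abstract bookkeeping (weights = sector probabilities of a grand-canonical trial state): if
`w_m ≥ 0`, `Σ_m w_m = 1`, `Σ_m w_m F(m) ≤ A` (ensemble variational bound), the second moment
`Σ_m w_m (2m − t)² ≤ V` is small and the target sector `n` lies ABOVE the mean (`g = 2n − t > 0`),
then a one-sided pair-addition cost `F(m+1) ≤ F(m) + C₀` (`m < n`) and an a-priori bound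
`F(n) ≤ F(m) + B` (`m > n`) give
`F(n) ≤ A + C₀ (ρ/2 + (V + g²)/(4ρ)) + B V/g²` for every `ρ > 0`
(Chebyshev for the tail `m > n`, AM–GM `|n − m| ≤ ρ/2 + (n−m)²/(2ρ)` for the bulk). Folklore.
-/

noncomputable section

namespace Summit.HubbardSuperconductivity.TwTipContinuation.IsogapTransport

open Finset

/-- Iterating a one-step cost: `F(m + j) ≤ F(m) + C₀ j` while `m + j ≤ n`. [folklore] -/
theorem iterate_cost {F : ℕ → ℝ} {C₀ : ℝ} {n : ℕ} (hadd : ∀ m, m < n → F (m + 1) ≤ F m + C₀) :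
    ∀ (j m : ℕ), m + j ≤ n → F (m + j) ≤ F m + C₀ * j := by
  intro j
  induction j with
  | zero => intro m _; simp
  | succ j ih =>
    intro m hm
    have h1 := ih m (by omega)
    have h2 := hadd (m + j) (by omega)
    rw [show m + (j + 1) = m + j + 1 by ring]
    push_cast
    linarith

/-- **Sector transfer.** See the module docstring. [folklore] -/
theorem sector_transfer {F w : ℕ → ℝ} {M n : ℕ} {A V C₀ B t ρ : ℝ} (hC₀ : 0 ≤ C₀) (hB : 0 ≤ B) (hρ : 0 < ρ)
    (hw : ∀ m ∈ Finset.range (M + 1), 0 ≤ w m) (hw1 : ∑ m ∈ Finset.range (M + 1), w m = 1)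
    (hA : ∑ m ∈ Finset.range (M + 1), w m * F m ≤ A)
    (hV : ∑ m ∈ Finset.range (M + 1), w m * (2 * m - t) ^ 2 ≤ V) (hg : 0 < 2 * n - t)
    (hadd : ∀ m, m < n → F (m + 1) ≤ F m + C₀) (hbig : ∀ m ∈ Finset.range (M + 1), n < m → F n ≤ F m + B) :
    F n ≤ A + C₀ * (ρ / 2 + (V + (2 * n - t) ^ 2) / (4 * ρ)) + B * (V / (2 * n - t) ^ 2) := by
  set g : ℝ := 2 * n - t with hgdef
  -- pointwise: `F n ≤ F m + C₀ (ρ/2 + (n−m)²/(2ρ)) + B (2m−t)²/g²`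
  have hpt : ∀ m ∈ Finset.range (M + 1),
      F n ≤ F m + C₀ * (ρ / 2 + ((n : ℝ) - m) ^ 2 / (2 * ρ)) + B * ((2 * m - t) ^ 2 / g ^ 2) := by
    intro m hm
    have hamgm : |(n : ℝ) - m| ≤ ρ / 2 + ((n : ℝ) - m) ^ 2 / (2 * ρ) := by
      rw [abs_le]
      have h := sq_nonneg (|(n : ℝ) - m| - ρ)
      have hsq : |(n : ℝ) - m| ^ 2 = ((n : ℝ) - m) ^ 2 := sq_abs _
      have key : |(n : ℝ) - m| ≤ ρ / 2 + ((n : ℝ) - m) ^ 2 / (2 * ρ) := by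
        rw [show ρ / 2 + ((n : ℝ) - m) ^ 2 / (2 * ρ) = (ρ ^ 2 + ((n : ℝ) - m) ^ 2) / (2 * ρ) by field_simp,
          le_div_iff₀ (by positivity)]
        nlinarith [abs_nonneg ((n : ℝ) - m)]
      constructor
      · linarith [neg_abs_le ((n : ℝ) - m)]
      · linarith [le_abs_self ((n : ℝ) - m)]
    have hterm2 : 0 ≤ B * ((2 * m - t) ^ 2 / g ^ 2) := by positivity
    rcases le_or_gt m n with hle | hlt
    · obtain ⟨j, rfl⟩ : ∃ j, n = m + j := ⟨n - m, by omega⟩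
      have h1 := iterate_cost hadd j m le_rfl
      have hj : (j : ℝ) = |((m + j : ℕ) : ℝ) - m| := by push_cast; rw [add_sub_cancel_left, Nat.abs_cast]
      have h2 : C₀ * (j : ℝ) ≤ C₀ * (ρ / 2 + (((m + j : ℕ) : ℝ) - m) ^ 2 / (2 * ρ)) := by
        rw [hj]; exact mul_le_mul_of_nonneg_left hamgm hC₀
      linarith
    · have h1 := hbig m hm hlt
      have htail : 1 ≤ (2 * m - t) ^ 2 / g ^ 2 := by
        rw [le_div_iff₀ (by positivity), one_mul]
        have : (n : ℝ) + 1 ≤ m := by exact_mod_cast hlt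
        have h2 : g ≤ 2 * m - t := by rw [hgdef]; linarith
        nlinarith
      have h3 : B ≤ B * ((2 * m - t) ^ 2 / g ^ 2) := by nlinarith
      have h4 : 0 ≤ C₀ * (ρ / 2 + ((n : ℝ) - m) ^ 2 / (2 * ρ)) := by positivity
      linarith
  -- average with the weights
  have hsum : F n ≤ ∑ m ∈ Finset.range (M + 1), w m * (F m + C₀ * (ρ / 2 + ((n : ℝ) - m) ^ 2 / (2 * ρ)) +
      B * ((2 * m - t) ^ 2 / g ^ 2)) := by
    calc F n = ∑ m ∈ Finset.range (M + 1), w m * F n := by rw [← Finset.sum_mul, hw1, one_mul]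
      _ ≤ _ := Finset.sum_le_sum fun m hm => mul_le_mul_of_nonneg_left (hpt m hm) (hw m hm)
  -- evaluate the averages
  have hsq : ∀ m : ℕ, ((n : ℝ) - m) ^ 2 ≤ ((2 * m - t) ^ 2 + g ^ 2) / 2 := fun m => by
    rw [hgdef]; nlinarith [sq_nonneg (2 * (m : ℝ) - t + (2 * n - t))]
  have hmid : ∑ m ∈ Finset.range (M + 1), w m * ((n : ℝ) - m) ^ 2 ≤ (V + g ^ 2) / 2 := by
    calc ∑ m ∈ Finset.range (M + 1), w m * ((n : ℝ) - m) ^ 2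
        ≤ ∑ m ∈ Finset.range (M + 1), w m * (((2 * m - t) ^ 2 + g ^ 2) / 2) :=
          Finset.sum_le_sum fun m hm => mul_le_mul_of_nonneg_left (hsq m) (hw m hm)
      _ = (∑ m ∈ Finset.range (M + 1), w m * (2 * m - t) ^ 2 + (∑ m ∈ Finset.range (M + 1), w m) * g ^ 2) / 2 := by
          rw [Finset.sum_mul, ← Finset.sum_add_distrib, eq_div_iff (two_ne_zero), Finset.sum_mul]
          exact Finset.sum_congr rfl fun m _ => by ring
      _ ≤ (V + g ^ 2) / 2 := by rw [hw1, one_mul]; linarith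
  have hexp : ∑ m ∈ Finset.range (M + 1), w m * (F m + C₀ * (ρ / 2 + ((n : ℝ) - m) ^ 2 / (2 * ρ)) +
      B * ((2 * m - t) ^ 2 / g ^ 2)) =
      ∑ m ∈ Finset.range (M + 1), w m * F m + C₀ * (ρ / 2) * ∑ m ∈ Finset.range (M + 1), w m +
        C₀ / (2 * ρ) * ∑ m ∈ Finset.range (M + 1), w m * ((n : ℝ) - m) ^ 2 +
        B / g ^ 2 * ∑ m ∈ Finset.range (M + 1), w m * (2 * m - t) ^ 2 := by
    rw [Finset.mul_sum, Finset.mul_sum, Finset.mul_sum, ← Finset.sum_add_distrib, ← Finset.sum_add_distrib,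
      ← Finset.sum_add_distrib]
    exact Finset.sum_congr rfl fun m _ => by field_simp; ring
  rw [hexp, hw1, mul_one] at hsum
  have h1 : C₀ / (2 * ρ) * ∑ m ∈ Finset.range (M + 1), w m * ((n : ℝ) - m) ^ 2 ≤ C₀ / (2 * ρ) * ((V + g ^ 2) / 2) :=
    mul_le_mul_of_nonneg_left hmid (by positivity)
  have h2 : B / g ^ 2 * ∑ m ∈ Finset.range (M + 1), w m * (2 * m - t) ^ 2 ≤ B / g ^ 2 * V :=
    mul_le_mul_of_nonneg_left hV (by positivity)
  have e : C₀ * (ρ / 2) + C₀ / (2 * ρ) * ((V + g ^ 2) / 2) = C₀ * (ρ / 2 + (V + g ^ 2) / (4 * ρ)) := by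
    field_simp; ring
  have e2 : B / g ^ 2 * V = B * (V / g ^ 2) := by field_simp
  linarith

/-- **Sector transfer (piece 3a(v) of `stub_edgeOrder`)**, closed form. [folklore] -/
theorem sectorTransfer_bound :
    ∀ (F w : ℕ → ℝ) (M n : ℕ) (A V C₀ B t ρ : ℝ), 0 ≤ C₀ → 0 ≤ B → 0 < ρ → (∀ m ∈ Finset.range (M + 1), 0 ≤ w m) → ∑ m ∈ Finset.range (M + 1), w m = 1 → ∑ m ∈ Finset.range (M + 1), w m * F m ≤ A → ∑ m ∈ Finset.range (M + 1), w m * (2 * m - t) ^ 2 ≤ V → 0 < 2 * n - t → (∀ m, m < n → F (m + 1) ≤ F m + C₀) → (∀ m ∈ Finset.range (M + 1), n < m → F n ≤ F m + B) → F n ≤ A + C₀ * (ρ / 2 + (V + (2 * n - t) ^ 2) / (4 * ρ)) + B * (V / (2 * n - t) ^ 2) :=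
  fun _ _ _ _ _ _ _ _ _ _ hC₀ hB hρ hw hw1 hA hV hg hadd hbig => sector_transfer hC₀ hB hρ hw hw1 hA hV hg hadd hbig

end Summit.HubbardSuperconductivity.TwTipContinuation.IsogapTransport
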